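import Summits.QuantumFields.BalabanUV.T4Continuum.Support.TorusSlicing

/-!
# `BalabanUV.T4Continuum.Support.DirichletTubeBounds` — NE2 (node U1a) formalisation swarm, sub-row `T4-U1a.S-NE2-D1-DIRICHLET°`, supplier item
# «Δ1-HOLEFILL» (tube decay, part 2): THE TUBE CUTOFF `η(x) = φ(x_{μ₀})·η′(x′)` (a longitudinal profile × the transversal product cutoff of
# `DirichletHoleFillingCutoff`) and the three Caccioppoli budgets SLICE BY SLICE — (L) the plateau energy, (E) the transition mass split into
# transversal slabs (per slice) and longitudinal ramps, (S) the source pairing (unit b2b-balaban-t4-ne2-formalise-leaf-08, gen 6, file 12)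

HONEST FRAMING.  Rung (B)+1 bookkeeping at MODEL level (one lattice field, finite torus); [folklore]; NE2 (U1a) is NOT proved by this file;
spine PROVED 0/9 unchanged; NOT infinite volume, NOT the mass gap, NOT Clay.  HONEST DEPENDENCY (verbatim): «continuum YM on T⁴ ⇐ BetaPertH ∧
nine spine estimates (0/9 proved); BetaPertH ⇐ (D1) ∧ (D4) ∧ CAP+tail; G-an2-4 gates asym, D1 and NE2/3/4.»

WHAT THIS FILE PROVES (0 sorry).  Torus `Tor N`, `N : Fin (d+1) → ℕ`, a longitudinal direction `μ₀`, slices `zsl t` on `Tor N′` (`TorusSlicing`),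
a transversal chart `chart N′ b′` of side `4k = n + 1` and its cutoff `η′ = eta N′ k b′`, an arbitrary longitudinal profile `φ : ZMod (N μ₀) → ℝ`
with `0 ≤ φ ≤ 1`, and the TUBE CUTOFF `etaT x = φ (x μ₀) · η′ (removeNth μ₀ x)`:
 * (L) **`lower_bound_tube`**: `‖c‖²·Σ_t φ(t)²·dirOn (inner k) (zsl t ∘ chart b′) ≤ Σ_ν Σ_x etaT(x+e_ν)²‖(∂_ν z)(x)‖²`;
 * (E) **`error_bound_tube`**: `Σ_ν Σ_x (etaT(x+e_ν) − etaT x)²(7∕2‖z x‖² + ½‖z(x+e_ν)‖²) ≤ Σ_t φ(t)²·(4/(k−1)²)·(slab mass of slice t)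
   + ℓ²·Σ_{t ∈ T} (7∕2·Σ_j‖(zsl t)(chart j)‖² + ½·Σ_j‖(zsl (t+1))(chart j)‖²)` whenever `|φ(t+1) − φ t| ≤ ℓ` and `φ(t+1) ≠ φ t ⇒ t ∈ T`
   (transversal bonds: `DirichletHoleFilling.error_bound` per slice; longitudinal bonds: `η′² ≤` chart indicator);
 * (S) **`source_bound_tube`**: `Re⟨etaT²z, 1_ΩΔz⟩ ≤ Σ_t φ(t)²·√(Σ_j‖(zsl t)(chart j)‖²)·√(Σ_j‖(1_ΩΔz)(ins t (chart j))‖²)`.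
The tube hole-filling step and its iteration are files 13–14.

ABSOLUTE RULE (cell, verbatim): «No internally-minted statement may enter as a cited fact. Every hypothesis is either kernel-proved in
this package or a verbatim quotation of a PUBLISHED theorem with page reference. The manuscript(s) under audit are NOT citable for
their own disputed steps — they are the thing under adjudication; programme-internal (2001/route/tribunal) claims are never citable.»
[folklore]; one data `def` (`etaT`), no `def … : Prop` fact.  NOT CLAIMED: anything at the residue; NE2.
-/

noncomputable section

open scoped BigOperators ComplexConjugate Matrix
open Finset

namespace Summit.QuantumFields.BalabanUV.T4Continuum.DirichletTubeBounds

open Literature.MathematicalPhysics.QuantumFieldTheory.Balaban1983to89.B5Prop11Plancherel (Tor unitVec)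
open Literature.MathematicalPhysics.QuantumFieldTheory.Balaban1983to89.B5Action121 (sdiff LapS sdiff_mulVec)
open Literature.MathematicalPhysics.QuantumFieldTheory.Balaban1983to89.Beta.CoordCubePoincare (stepUp)
open Summit.QuantumFields.BalabanUV.T4Continuum.DirichletDirectionalBesov (star_dotProduct_eq_sum restrictTo)
open Summit.QuantumFields.BalabanUV.T4Continuum.DirichletDirectionalBesovCutoff (cut)
open Summit.QuantumFields.BalabanUV.T4Continuum.CoordSlabPoincare (dirOn lo)
open Summit.QuantumFields.BalabanUV.T4Continuum.CoordSlabPoincareHi (hi)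
open Summit.QuantumFields.BalabanUV.T4Continuum.CoordAnnulusPoincare (inner)
open Summit.QuantumFields.BalabanUV.T4Continuum.DirichletHoleFillingCutoff (chart chart_stepUp eta eta_nonneg eta_le_one eta_le_indicator
  sum_pull)
open Summit.QuantumFields.BalabanUV.T4Continuum.DirichletHoleFilling (lower_bound error_bound)
open Summit.QuantumFields.BalabanUV.T4Continuum.TorusSlicing (Nsl ins zsl ins_apply_self sum_torus_slice ins_add_unitVec_succAbove
  ins_add_unitVec_self sdiff_succAbove_ins sum_dir_succAbove)

variable {d : ℕ} (N : Fin (d + 1) → ℕ) [hN : ∀ μ, NeZero (N μ)] (μ₀ : Fin (d + 1)) {n : ℕ} (k : ℕ) (b' : Tor (Nsl N μ₀))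
  (φ : ZMod (N μ₀) → ℝ)

/-! ## §1 The tube cutoff -/

/-- the TUBE CUTOFF `η(x) = φ(x_{μ₀}) · η′(transversal part of x)`. [folklore] -/
def etaT (x : Tor N) : ℝ := φ (x μ₀) * eta (Nsl N μ₀) (n := n) k b' (Fin.removeNth μ₀ x)

omit hN in
/-- on a slice point: `etaT (ins t y) = φ t · η′ y`. [folklore] -/
theorem etaT_ins (t : ZMod (N μ₀)) (y : Tor (Nsl N μ₀)) : etaT N μ₀ (n := n) k b' φ (ins N μ₀ t y) = φ t * eta (Nsl N μ₀) (n := n) k b' y := by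
  rw [etaT, ins_apply_self]; unfold ins; rw [Fin.removeNth_insertNth]

omit hN in
/-- `0 ≤ etaT` when `0 ≤ φ`. [folklore] -/
theorem etaT_nonneg (hk : 2 ≤ k) (hn : 4 * k = n + 1) (hφ0 : ∀ t, 0 ≤ φ t) (x : Tor N) : 0 ≤ etaT N μ₀ (n := n) k b' φ x :=
  mul_nonneg (hφ0 _) (eta_nonneg _ k b' hk hn _)

omit hN in
/-- every torus point is a slice point. [folklore] -/
theorem ins_removeNth (x : Tor N) : ins N μ₀ (x μ₀) (Fin.removeNth μ₀ x) = x := Fin.insertNth_self_removeNth μ₀ x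

/-- the chart-indicator pairing on a slice: `Σ_y η′(y)²·(‖u y‖·‖v y‖) ≤ √(Σ_j ‖u(chart j)‖²)·√(Σ_j ‖v(chart j)‖²)`. [folklore] -/
theorem slice_pairing_le (hk : 2 ≤ k) (hn : 4 * k = n + 1) (hN' : ∀ ν, n + 1 ≤ Nsl N μ₀ ν) (u v : Tor (Nsl N μ₀) → ℂ) :
    ∑ y : Tor (Nsl N μ₀), eta (Nsl N μ₀) (n := n) k b' y ^ 2 * (‖u y‖ * ‖v y‖)
      ≤ Real.sqrt (∑ j : Fin d → Fin (n + 1), ‖u (chart (Nsl N μ₀) b' j)‖ ^ 2)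
        * Real.sqrt (∑ j : Fin d → Fin (n + 1), ‖v (chart (Nsl N μ₀) b' j)‖ ^ 2) := by
  have h1 : ∀ y, eta (Nsl N μ₀) (n := n) k b' y ^ 2 * (‖u y‖ * ‖v y‖)
      ≤ (∑ j : Fin d → Fin (n + 1), if chart (Nsl N μ₀) b' j = y then (1 : ℝ) else 0) * (‖u y‖ * ‖v y‖) := by
    intro y
    have he0 := eta_nonneg (Nsl N μ₀) k b' hk hn y
    have he1 := eta_le_one (Nsl N μ₀) k b' hk hn hN' y
    have hind := eta_le_indicator (Nsl N μ₀) k b' hk hn y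
    refine mul_le_mul_of_nonneg_right ?_ (by positivity)
    nlinarith
  refine (Finset.sum_le_sum fun y _ => h1 y).trans ?_
  rw [sum_pull (Nsl N μ₀) b' univ (fun _ => (1 : ℝ)) (fun y => ‖u y‖ * ‖v y‖)]
  simp only [one_mul]
  exact Real.sum_mul_le_sqrt_mul_sqrt univ (fun j => ‖u (chart (Nsl N μ₀) b' j)‖) (fun j => ‖v (chart (Nsl N μ₀) b' j)‖)

/-! ## §2 (L) the plateau energy -/

variable (c : ℂ) (z : Tor N → ℂ)

/-- **(L) for the tube**: `‖c‖²·Σ_t φ(t)²·dirOn (inner k) (zsl t ∘ chart b′) ≤ Σ_ν Σ_x etaT(x+e_ν)²‖(∂_ν z)(x)‖²` (drop the longitudinal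
bonds, slice the rest, `DirichletHoleFilling.lower_bound` on every slice). [folklore] -/
theorem lower_bound_tube (hk : 2 ≤ k) (hn : 4 * k = n + 1) (hN' : ∀ ν, n + 1 ≤ Nsl N μ₀ ν) :
    ‖c‖ ^ 2 * ∑ t : ZMod (N μ₀), φ t ^ 2 * dirOn (inner (n := n) k) (zsl N μ₀ z t ∘ chart (Nsl N μ₀) (n := n) b')
      ≤ ∑ ν : Fin (d + 1), ∑ x : Tor N, etaT N μ₀ (n := n) k b' φ (x + unitVec N ν) ^ 2 * ‖(sdiff N c ν *ᵥ z) x‖ ^ 2 := by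
  rw [sum_dir_succAbove μ₀]
  have h0 : 0 ≤ ∑ x : Tor N, etaT N μ₀ (n := n) k b' φ (x + unitVec N μ₀) ^ 2 * ‖(sdiff N c μ₀ *ᵥ z) x‖ ^ 2 :=
    Finset.sum_nonneg fun _ _ => by positivity
  refine le_trans ?_ (le_add_of_nonneg_left h0)
  -- slice every transversal direction
  have hslice : ∀ j : Fin d, ∑ x : Tor N, etaT N μ₀ (n := n) k b' φ (x + unitVec N (μ₀.succAbove j)) ^ 2 * ‖(sdiff N c (μ₀.succAbove j) *ᵥ z) x‖ ^ 2
      = ∑ t : ZMod (N μ₀), φ t ^ 2 * ∑ y : Tor (Nsl N μ₀),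
          eta (Nsl N μ₀) (n := n) k b' (y + unitVec (Nsl N μ₀) j) ^ 2 * ‖(sdiff (Nsl N μ₀) c j *ᵥ zsl N μ₀ z t) y‖ ^ 2 := by
    intro j
    rw [sum_torus_slice N μ₀]
    refine Finset.sum_congr rfl fun t _ => ?_
    rw [Finset.mul_sum]
    refine Finset.sum_congr rfl fun y _ => ?_
    rw [ins_add_unitVec_succAbove, etaT_ins, sdiff_succAbove_ins]; ring
  rw [Finset.sum_congr rfl fun j _ => hslice j, Finset.sum_comm, Finset.mul_sum]
  refine Finset.sum_le_sum fun t _ => ?_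
  rw [← Finset.mul_sum, mul_left_comm]
  exact mul_le_mul_of_nonneg_left (lower_bound (Nsl N μ₀) k b' c (zsl N μ₀ z t) hk hn hN') (sq_nonneg _)

/-! ## §3 (E) the transition mass -/

/-- **(E) for the tube**: transversal transitions slice by slice (`error_bound`), longitudinal transitions on the ramps of `φ`. [folklore] -/
theorem error_bound_tube (hk : 2 ≤ k) (hn : 4 * k = n + 1) (hN' : ∀ ν, n + 1 ≤ Nsl N μ₀ ν)
    {ℓ : ℝ} (hφL : ∀ t, |φ (t + 1) - φ t| ≤ ℓ) (T : Finset (ZMod (N μ₀))) (hT : ∀ t, φ (t + 1) ≠ φ t → t ∈ T) :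
    ∑ ν : Fin (d + 1), ∑ x : Tor N, (etaT N μ₀ (n := n) k b' φ (x + unitVec N ν) - etaT N μ₀ (n := n) k b' φ x) ^ 2
        * (7 / 2 * ‖z x‖ ^ 2 + 1 / 2 * ‖z (x + unitVec N ν)‖ ^ 2)
      ≤ (∑ t : ZMod (N μ₀), φ t ^ 2 * (4 / ((k : ℝ) - 1) ^ 2 * ∑ j : Fin d,
            (∑ y ∈ lo (n := n) j k, ‖(zsl N μ₀ z t ∘ chart (Nsl N μ₀) b') y‖ ^ 2
              + ∑ y ∈ hi (n := n) j k, ‖(zsl N μ₀ z t ∘ chart (Nsl N μ₀) b') y‖ ^ 2)))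
        + ℓ ^ 2 * ∑ t ∈ T, (7 / 2 * ∑ j : Fin d → Fin (n + 1), ‖zsl N μ₀ z t (chart (Nsl N μ₀) b' j)‖ ^ 2
            + 1 / 2 * ∑ j : Fin d → Fin (n + 1), ‖zsl N μ₀ z (t + 1) (chart (Nsl N μ₀) b' j)‖ ^ 2) := by
  rw [sum_dir_succAbove μ₀, add_comm]
  refine add_le_add ?_ ?_
  · -- transversal bonds: slice, factor `φ(t)²`, per-slice `error_bound`
    have hslice : ∀ j : Fin d, ∑ x : Tor N, (etaT N μ₀ (n := n) k b' φ (x + unitVec N (μ₀.succAbove j)) - etaT N μ₀ (n := n) k b' φ x) ^ 2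
          * (7 / 2 * ‖z x‖ ^ 2 + 1 / 2 * ‖z (x + unitVec N (μ₀.succAbove j))‖ ^ 2)
        = ∑ t : ZMod (N μ₀), φ t ^ 2 * ∑ y : Tor (Nsl N μ₀),
            (eta (Nsl N μ₀) (n := n) k b' (y + unitVec (Nsl N μ₀) j) - eta (Nsl N μ₀) (n := n) k b' y) ^ 2
              * (7 / 2 * ‖zsl N μ₀ z t y‖ ^ 2 + 1 / 2 * ‖zsl N μ₀ z t (y + unitVec (Nsl N μ₀) j)‖ ^ 2) := by
      intro j
      rw [sum_torus_slice N μ₀]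
      refine Finset.sum_congr rfl fun t _ => ?_
      rw [Finset.mul_sum]
      refine Finset.sum_congr rfl fun y _ => ?_
      rw [ins_add_unitVec_succAbove, etaT_ins, etaT_ins]
      simp only [zsl]
      ring
    rw [Finset.sum_congr rfl fun j _ => hslice j, Finset.sum_comm]
    refine Finset.sum_le_sum fun t _ => ?_
    rw [← Finset.mul_sum]
    exact mul_le_mul_of_nonneg_left (error_bound (Nsl N μ₀) k b' (zsl N μ₀ z t) hk hn hN') (sq_nonneg _)
  · -- longitudinal bonds: `(φ(t+1) − φ t)²·η′(y)²`, `η′² ≤` chart indicator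
    rw [sum_torus_slice N μ₀]
    have hper : ∀ t : ZMod (N μ₀), ∑ y : Tor (Nsl N μ₀),
          (etaT N μ₀ (n := n) k b' φ (ins N μ₀ t y + unitVec N μ₀) - etaT N μ₀ (n := n) k b' φ (ins N μ₀ t y)) ^ 2
            * (7 / 2 * ‖z (ins N μ₀ t y)‖ ^ 2 + 1 / 2 * ‖z (ins N μ₀ t y + unitVec N μ₀)‖ ^ 2)
        ≤ (φ (t + 1) - φ t) ^ 2 * (7 / 2 * ∑ j : Fin d → Fin (n + 1), ‖zsl N μ₀ z t (chart (Nsl N μ₀) b' j)‖ ^ 2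
            + 1 / 2 * ∑ j : Fin d → Fin (n + 1), ‖zsl N μ₀ z (t + 1) (chart (Nsl N μ₀) b' j)‖ ^ 2) := by
      intro t
      have hpt : ∀ y : Tor (Nsl N μ₀),
          (etaT N μ₀ (n := n) k b' φ (ins N μ₀ t y + unitVec N μ₀) - etaT N μ₀ (n := n) k b' φ (ins N μ₀ t y)) ^ 2
            * (7 / 2 * ‖z (ins N μ₀ t y)‖ ^ 2 + 1 / 2 * ‖z (ins N μ₀ t y + unitVec N μ₀)‖ ^ 2)
          ≤ (φ (t + 1) - φ t) ^ 2 * ((∑ j : Fin d → Fin (n + 1), if chart (Nsl N μ₀) b' j = y then (1 : ℝ) else 0)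
              * (7 / 2 * ‖zsl N μ₀ z t y‖ ^ 2 + 1 / 2 * ‖zsl N μ₀ z (t + 1) y‖ ^ 2)) := by
        intro y
        rw [ins_add_unitVec_self, etaT_ins, etaT_ins, ← sub_mul, mul_pow]
        have he0 := eta_nonneg (Nsl N μ₀) k b' hk hn y
        have he1 := eta_le_one (Nsl N μ₀) k b' hk hn hN' y
        have hind := eta_le_indicator (Nsl N μ₀) k b' hk hn y
        have hm : 0 ≤ 7 / 2 * ‖zsl N μ₀ z t y‖ ^ 2 + 1 / 2 * ‖zsl N μ₀ z (t + 1) y‖ ^ 2 := by positivity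
        simp only [zsl]
        rw [mul_assoc]
        refine mul_le_mul_of_nonneg_left ?_ (sq_nonneg _)
        refine mul_le_mul_of_nonneg_right ?_ hm
        nlinarith
      refine (Finset.sum_le_sum fun y _ => hpt y).trans ?_
      rw [← Finset.mul_sum, sum_pull (Nsl N μ₀) b' univ (fun _ => (1 : ℝ))]
      simp only [one_mul]
      rw [Finset.sum_add_distrib, ← Finset.mul_sum, ← Finset.mul_sum]
    refine (Finset.sum_le_sum fun t _ => hper t).trans ?_
    -- only `t ∈ T` contribute, each with weight `≤ ℓ²`
    have hzero : ∀ t, t ∉ T → (φ (t + 1) - φ t) ^ 2 * (7 / 2 * ∑ j : Fin d → Fin (n + 1), ‖zsl N μ₀ z t (chart (Nsl N μ₀) b' j)‖ ^ 2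
        + 1 / 2 * ∑ j : Fin d → Fin (n + 1), ‖zsl N μ₀ z (t + 1) (chart (Nsl N μ₀) b' j)‖ ^ 2) = 0 := by
      intro t ht
      have : φ (t + 1) = φ t := by by_contra h; exact ht (hT t h)
      rw [this, sub_self]; ring
    rw [← Finset.sum_subset (Finset.subset_univ T) (fun t _ ht => hzero t ht), Finset.mul_sum]
    refine Finset.sum_le_sum fun t _ => ?_
    have hm : 0 ≤ 7 / 2 * ∑ j : Fin d → Fin (n + 1), ‖zsl N μ₀ z t (chart (Nsl N μ₀) b' j)‖ ^ 2
        + 1 / 2 * ∑ j : Fin d → Fin (n + 1), ‖zsl N μ₀ z (t + 1) (chart (Nsl N μ₀) b' j)‖ ^ 2 := by positivity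
    refine mul_le_mul_of_nonneg_right ?_ hm
    have h := hφL t
    rw [← sq_abs]
    exact pow_le_pow_left₀ (abs_nonneg _) h 2

/-! ## §4 (S) the source -/

/-- **(S) for the tube**: `Re⟨etaT² z, 1_ΩΔz⟩ ≤ Σ_t φ(t)²·√(Σ_j ‖(zsl t)(chart j)‖²)·√(Σ_j ‖(1_ΩΔz)(ins t (chart j))‖²)`. [folklore] -/
theorem source_bound_tube (hk : 2 ≤ k) (hn : 4 * k = n + 1) (hN' : ∀ ν, n + 1 ≤ Nsl N μ₀ ν) {Ω : Tor N → Prop} [DecidablePred Ω] :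
    (star (cut N (fun y => etaT N μ₀ (n := n) k b' φ y ^ 2) z) ⬝ᵥ restrictTo Ω (LapS N c *ᵥ z)).re
      ≤ ∑ t : ZMod (N μ₀), φ t ^ 2 * (Real.sqrt (∑ j : Fin d → Fin (n + 1), ‖zsl N μ₀ z t (chart (Nsl N μ₀) b' j)‖ ^ 2)
          * Real.sqrt (∑ j : Fin d → Fin (n + 1), ‖restrictTo Ω (LapS N c *ᵥ z) (ins N μ₀ t (chart (Nsl N μ₀) b' j))‖ ^ 2)) := by
  set r := restrictTo Ω (LapS N c *ᵥ z) with hr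
  rw [star_dotProduct_eq_sum, Complex.re_sum, sum_torus_slice N μ₀]
  refine Finset.sum_le_sum fun t _ => ?_
  have h1 : ∀ y : Tor (Nsl N μ₀), (conj (cut N (fun w => etaT N μ₀ (n := n) k b' φ w ^ 2) z (ins N μ₀ t y)) * r (ins N μ₀ t y)).re
      ≤ φ t ^ 2 * (eta (Nsl N μ₀) (n := n) k b' y ^ 2 * (‖zsl N μ₀ z t y‖ * ‖r (ins N μ₀ t y)‖)) := by
    intro y
    calc (conj (cut N (fun w => etaT N μ₀ (n := n) k b' φ w ^ 2) z (ins N μ₀ t y)) * r (ins N μ₀ t y)).re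
        ≤ ‖conj (cut N (fun w => etaT N μ₀ (n := n) k b' φ w ^ 2) z (ins N μ₀ t y)) * r (ins N μ₀ t y)‖ := Complex.re_le_norm _
      _ = etaT N μ₀ (n := n) k b' φ (ins N μ₀ t y) ^ 2 * (‖zsl N μ₀ z t y‖ * ‖r (ins N μ₀ t y)‖) := by
          rw [norm_mul, Complex.norm_conj, cut, norm_mul, Complex.norm_real, Real.norm_of_nonneg (sq_nonneg _), mul_assoc]; rfl
      _ = φ t ^ 2 * (eta (Nsl N μ₀) (n := n) k b' y ^ 2 * (‖zsl N μ₀ z t y‖ * ‖r (ins N μ₀ t y)‖)) := by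
          rw [etaT_ins, mul_pow, mul_assoc]
  refine (Finset.sum_le_sum fun y _ => h1 y).trans ?_
  rw [← Finset.mul_sum]
  refine mul_le_mul_of_nonneg_left ?_ (sq_nonneg _)
  exact slice_pairing_le N μ₀ k b' hk hn hN' (zsl N μ₀ z t) (fun y => r (ins N μ₀ t y))

end Summit.QuantumFields.BalabanUV.T4Continuum.DirichletTubeBounds

end
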